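import Mathlib
import HarnessLib
import Summits.QuantumFields.Statement
import Summits.QuantumFields.QCD.Theses.HeatSlicedQuarks
import Literature.MathematicalPhysics.QuantumLattice.LatticeTori

/-!
# Sketch — first lemmas for crux ideas on `HeatSlicedQuarks.ActionBoundsLowModes` (stmt-QuantumFields-8872)

planner-cruxidea-stmt-QuantumFields-8872-1-0, round 1.  Nothing here is proved; every `def … : Prop`
is a candidate FIRST LEMMA of a line, stated over existing declarations only
(`wilsonDirac`, `fundamentalRep`, `plaquetteHolonomy`, `GaugeConfig`, `Site.shift`, `torusDist`).

* `MassPencil`         — exact identity `‖D(m)v‖² = ‖D(0)v‖² + m·⟨v,K_U v⟩ + m²‖v‖²` (remark shared by all lines).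
* `EpsRegularity`      — card `equal-action-cubes`: small LOCAL action ⇒ ≤ C₀ modes below 1/r² supported in the r-ball.
* `CovariantSemigroupDomination` — card `holonomy-blind-dominated-clr`: |e^{-tK_U} v| ≤ e^{-tK_1}|v| fibrewise.
* `BundleCLR`          — the junction both lines reach: discrete magnetic CLR for the U(3)⊗spin bundle Laplacian
                          on the 4-torus, `dim E ≤ C (Σ_x W(x)² + 1)`.
-/

namespace Summit.QuantumFields.QCD.Cruxes.ActionBoundsLowModes.Sketch

open scoped BigOperators Matrix ComplexConjugate
open Literature.MathematicalPhysics.QuantumLattice Literature.MathematicalPhysics.QuantumFieldTheory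
  Literature.Probability.LatticeModels

/-- Shorthand: the quark-field index type on the torus of side `L`. -/
abbrev QIdx (L : ℕ) : Type := TorusSite 4 L × Fin 3 × Fin 4

/-- Shorthand: the tree's Wilson–Dirac operator for `SU(3)`, `r = 1`. -/
noncomputable abbrev DW {L : ℕ} [NeZero L]
    (U : GaugeConfig 4 L (Matrix.specialUnitaryGroup (Fin 3) ℂ)) (m : ℝ) : Matrix (QIdx L) (QIdx L) ℂ :=
  wilsonDirac (fundamentalRep (Fin 3)) U m 1

/-- The covariant Dirichlet (kinetic) form `⟨v, K_U v⟩ = Σ_{x,μ} ‖U(x,μ) v(x+μ̂) − v(x)‖²`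
(same expression as the left side of `HeatSlicedQuarks.WilsonLichnerowicz`, without the factor ½). -/
noncomputable def covForm {L : ℕ} [NeZero L]
    (U : GaugeConfig 4 L (Matrix.specialUnitaryGroup (Fin 3) ℂ)) (v : QIdx L → ℂ) : ℝ :=
  ∑ x : TorusSite 4 L, ∑ μ : Fin 4, ∑ a : Fin 3, ∑ α : Fin 4,
    ‖(∑ b : Fin 3, (fundamentalRep (Fin 3) (U (x, μ))) a b * v (Site.shift x μ, b, α)) - v (x, a, α)‖ ^ 2

/-- The covariant (bundle) Laplacian `K_U = 8 − Σ_μ (T_μ + T_μ†)` on `ℓ²(𝕋_L⁴; ℂ³ ⊗ ℂ⁴)` as a matrix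
(colour transported by `U`, spin untouched); its quadratic form is `covForm`. -/
noncomputable def covLap {L : ℕ} [NeZero L]
    (U : GaugeConfig 4 L (Matrix.specialUnitaryGroup (Fin 3) ℂ)) : Matrix (QIdx L) (QIdx L) ℂ :=
  Matrix.of fun p q =>
    (if p = q then (8 : ℂ) else 0) -
      ∑ μ : Fin 4,
        ((if q.1 = Site.shift p.1 μ ∧ p.2.2 = q.2.2 then (fundamentalRep (Fin 3) (U (p.1, μ))) p.2.1 q.2.1 else 0) +
         (if p.1 = Site.shift q.1 μ ∧ p.2.2 = q.2.2 then (fundamentalRep (Fin 3) (U (q.1, μ))⁻¹) p.2.1 q.2.1 else 0))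

/-- The free scalar lattice Laplacian `K₁ = 8 − Σ_μ (S_μ + S_μ†)` on `ℓ²(𝕋_L⁴; ℝ)`. -/
noncomputable def freeLap (L : ℕ) [NeZero L] : Matrix (TorusSite 4 L) (TorusSite 4 L) ℝ :=
  Matrix.of fun x y =>
    (if x = y then (8 : ℝ) else 0) -
      ∑ μ : Fin 4, ((if y = Site.shift x μ then (1 : ℝ) else 0) + (if x = Site.shift y μ then (1 : ℝ) else 0))

/-- REMARK (mass pencil; exact). `γ₅ D_W(m) = H_W(m)` is Hermitian and `{γ₅, H_W(m₀)} = 2 Re D_W(m₀)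
= 2m₀ + K_U`, hence `D(m)†D(m) = D(0)†D(0) + m K_U + m²` as forms: the whole `m`-dependence of
`H_U` is affine with slope the bosonic covariant Laplacian.  Consequences: the mode count is
non-increasing in `m` on `[0,1]`, and `WilsonLichnerowicz` for all `m ∈ [-1/2,1]` follows from the
single bound `D(0)†D(0) ≥ K_U − C·V` at `m = 0` (since `(1+m)K_U ≥ ½K_U`). -/
def MassPencil : Prop :=
  ∀ (L : ℕ) [NeZero L] (U : GaugeConfig 4 L (Matrix.specialUnitaryGroup (Fin 3) ℂ)) (m : ℝ)
    (v : QIdx L → ℂ),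
    ∑ i, ‖(DW U m).mulVec v i‖ ^ 2 =
      ∑ i, ‖(DW U 0).mulVec v i‖ ^ 2 + m * covForm U v + m ^ 2 * ∑ i, ‖v i‖ ^ 2

/-- FIRST LEMMA of card `equal-action-cubes` (ε-regularity for Wilson–Dirac low modes).
There are an absolute action threshold `θ > 0` and a constant `C₀` such that for every torus, field,
mass `m ∈ [-1/2,1]`, centre `x₀` and radius `r ≥ 1`: if the Wilson action carried by the plaquettes
based in the `ℓ^∞`-ball of radius `4r` about `x₀` is at most `θ`, then every subspace of quark fields
SUPPORTED in the ball of radius `r` on which `‖D_W v‖² ≤ r⁻² ‖v‖²` has dimension at most `C₀`.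
(Proof sketch: `MassPencil` + Lichnerowicz at `m=0`, Hölder `ℓ²·ℓ⁴·ℓ⁴` with `Σ V² ≤ C θ`, discrete
Sobolev `D^{1,2}(ℤ⁴) ⊂ ℓ⁴` for `|v|`, Kato `⟨v,K_Uv⟩ ≥ ⟨|v|,K₁|v|⟩`, then at most `C₀` eigenvalues of
the Dirichlet bundle Laplacian below `c/r²` by a one-scale dominated trace at `t = r²`.) -/
def EpsRegularity : Prop :=
  ∃ θ : ℝ, 0 < θ ∧ ∃ C₀ : ℝ, ∀ (L : ℕ) [NeZero L]
    (U : GaugeConfig 4 L (Matrix.specialUnitaryGroup (Fin 3) ℂ)) (m : ℝ), m ∈ Set.Icc (-(1 / 2 : ℝ)) 1 →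
    ∀ (x₀ : TorusSite 4 L) (r : ℕ), 1 ≤ r →
      (∑ y ∈ Finset.univ.filter (fun y : TorusSite 4 L => torusDist x₀ y ≤ 4 * r),
          ∑ μ : Fin 4, ∑ ν : Fin 4,
            (3 - ((fundamentalRep (Fin 3)) (plaquetteHolonomy U y μ ν)).trace.re) ≤ θ) →
      ∀ (E : Submodule ℂ (QIdx L → ℂ)),
        (∀ v ∈ E,
            (∀ (y : TorusSite 4 L) (a : Fin 3) (α : Fin 4), r < torusDist x₀ y → v (y, a, α) = 0) ∧
              ∑ i, ‖(DW U m).mulVec v i‖ ^ 2 ≤ (1 / (r : ℝ) ^ 2) * ∑ i, ‖v i‖ ^ 2) →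
        (Module.finrank ℂ E : ℝ) ≤ C₀

/-- FIRST LEMMA of card `holonomy-blind-dominated-clr` (Kato–Simon domination on the lattice bundle).
For every field and `t ≥ 0` the covariant heat semigroup is dominated fibrewise by the free scalar one:
`|e^{-tK_U} v|(x) ≤ (e^{-tK₁} |v|)(x)` with `|w|(x)` the `ℂ¹²`-norm of the fibre.  (Proof sketch:
`K_U = 8 − Hop_U`, `e^{-tK_U} = e^{-8t} Σ tⁿ Hop_Uⁿ/n!`, each lattice path carries a unitary
holonomy ⊗ 1_spin.)  This is the input of the Rozenblum–Solomyak dominated-semigroup CLR theorem. -/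
def CovariantSemigroupDomination : Prop :=
  ∀ (L : ℕ) [NeZero L] (U : GaugeConfig 4 L (Matrix.specialUnitaryGroup (Fin 3) ℂ)) (t : ℝ), 0 ≤ t →
    ∀ (v : QIdx L → ℂ) (x : TorusSite 4 L),
      Real.sqrt (∑ a : Fin 3, ∑ α : Fin 4, ‖(NormedSpace.exp (-(t : ℂ) • covLap U)).mulVec v (x, a, α)‖ ^ 2) ≤
        (NormedSpace.exp (-(t • freeLap L))).mulVec
          (fun y => Real.sqrt (∑ a : Fin 3, ∑ α : Fin 4, ‖v (y, a, α)‖ ^ 2)) x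

/-- THE JUNCTION both lines reach (discrete magnetic CLR for the bundle Laplacian on the 4-torus,
Courant–Fischer form): there is an absolute `C` such that for every field and every potential
`W ≥ 0` on sites, any subspace on which `½⟨v,K_U v⟩ ≤ Σ_x W(x)|v(x)|²` has dimension at most
`C (Σ_x W(x)² + 1)`.  With `W = C'·V + λ + L⁻²` and `HeatSlicedQuarks.WilsonLichnerowicz` this gives
`ActionBoundsLowModes` (since `Σ_x V(x)² ≤ C'' S_W(U)`, `Σ_x λ² = λ²L⁴`, `Σ_x L⁻⁴ = 1`). -/
def BundleCLR : Prop :=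
  ∃ C : ℝ, ∀ (L : ℕ) [NeZero L] (U : GaugeConfig 4 L (Matrix.specialUnitaryGroup (Fin 3) ℂ))
    (W : TorusSite 4 L → ℝ), (∀ x, 0 ≤ W x) →
    ∀ (E : Submodule ℂ (QIdx L → ℂ)),
      (∀ v ∈ E, (1 / 2 : ℝ) * covForm U v ≤
          ∑ x : TorusSite 4 L, W x * ∑ a : Fin 3, ∑ α : Fin 4, ‖v (x, a, α)‖ ^ 2) →
      (Module.finrank ℂ E : ℝ) ≤ C * (∑ x : TorusSite 4 L, W x ^ 2 + 1)

/-- Shape check: the junction plus Lichnerowicz is the intended route to the crux (stated, not proved). -/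
def JunctionClosesCrux : Prop :=
  BundleCLR → Summit.QuantumFields.QCD.Theses.HeatSlicedQuarks.WilsonLichnerowicz →
    Summit.QuantumFields.QCD.Theses.HeatSlicedQuarks.ActionBoundsLowModes

end Summit.QuantumFields.QCD.Cruxes.ActionBoundsLowModes.Sketch
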